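import Mathlib.Analysis.Calculus.Implicit
import Mathlib.Analysis.Calculus.ContDiff.RCLike
import Mathlib.Analysis.InnerProductSpace.PiL2
import Mathlib.Topology.Connected.LocallyConnected
import HarnessLib

/-!
# Regular zero sets of `C¹` maps: local connectedness and local solvability

Topic `Literature/Analysis/Calculus`. Elementary differential topology of the zero set
`Z = f⁻¹(0)` of a `C¹` map `f : E → F` between finite-dimensional real normed spaces near a
**regular** point `x ∈ Z` (`df_x` onto), from Mathlib's implicit function theorem
(`HasStrictFDerivAt.implicitToOpenPartialHomeomorph`: near `x`, `f` is conjugate to the projection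
`F × ker df_x → F`). These are the facts about regular level sets used in the Morse-theoretic count
of connected components in Khovanskii's theorem (J. Milnor, *Topology from the Differentiable
Viewpoint* (1965), §1–§2: a regular level set is a manifold; A. G. Khovanskii, *Fewnomials*
(1991), Ch. III). Everything is **proved**:

* `exists_nhds_subset_isConnected_inter` — a regular point of `Z` has arbitrarily small
  neighbourhoods `N` with `Z ∩ N` connected (so `Z` is locally connected at its regular points);
* `exists_nhds_inter_subset_connectedComponentIn` — at a regular point, the connected component of
  `Z` contains the trace on `Z` of a neighbourhood (it is a neighbourhood within `Z`);
* `isClosed_diff_connectedComponentIn` — if `f` is continuous (so `Z` is closed) and every point of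
  `Z` is regular, the complement in `Z` of a component is closed (components are open in `Z`);
* `eventually_exists_mem_eq` — **local solvability** at a regular point: every value near `f x`
  is attained in every neighbourhood of `x` (Mathlib `HasStrictFDerivAt.map_nhds_eq_of_surj`).

## References

* J. Milnor, *Topology from the Differentiable Viewpoint* (1965), §1 (regular values, the
  preimage theorem), §2. [MilnorTDV1965]
* A. G. Khovanskii, *Fewnomials*, Transl. Math. Monogr. 88, AMS (1991), Ch. III. [Khovanskii1991]
-/

noncomputable section

open Set Filter Metric Function
open scoped Topology

namespace Literature.Analysis.Calculus

variable {E F : Type*} [NormedAddCommGroup E] [NormedSpace ℝ E] [FiniteDimensional ℝ E]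
  [NormedAddCommGroup F] [NormedSpace ℝ F] [FiniteDimensional ℝ F]

/-- **Local connectedness of a zero set at a regular point.** If `f` is strictly differentiable
at a zero `x` with onto derivative, every neighbourhood `U` of `x` contains a neighbourhood `N`
of `x` such that `f⁻¹(0) ∩ N` is connected (in implicit-function coordinates `F × ker df_x`,
`N` is the preimage of a small ball and `f⁻¹(0) ∩ N` the image of a ball of `ker df_x`).
[cite: MilnorTDV1965, §1] -/
theorem exists_nhds_subset_isConnected_inter {f : E → F} {f' : E →L[ℝ] F} {x : E}
    (hf : HasStrictFDerivAt f f' x) (hf' : f'.range = ⊤) (hx : f x = 0) {U : Set E}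
    (hU : U ∈ 𝓝 x) : ∃ N ∈ 𝓝 x, N ⊆ U ∧ IsConnected ({z | f z = 0} ∩ N) := by
  haveI : CompleteSpace E := FiniteDimensional.complete ℝ E
  set φ := hf.implicitToOpenPartialHomeomorph f f' hf' with hφ
  have hxs : x ∈ φ.source := hf.mem_implicitToOpenPartialHomeomorph_source hf'
  have hφx : φ x = (0, 0) := by
    rw [hφ, hf.implicitToOpenPartialHomeomorph_self hf', hx]
  have hfst : ∀ z, (φ z).1 = f z := fun z => hf.implicitToOpenPartialHomeomorph_fst hf' z
  -- an open `U' ⊆ U` containing `x`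
  obtain ⟨U', hU'U, hU'o, hxU'⟩ := _root_.mem_nhds_iff.1 hU
  -- the open set `T = target ∩ φ.symm ⁻¹' U'` contains `(0, 0)`
  set T := φ.target ∩ φ.symm ⁻¹' U' with hT
  have hTo : IsOpen T := φ.symm.isOpen_inter_preimage hU'o
  have h0T : ((0 : F), (0 : f'.ker)) ∈ T := by
    refine ⟨?_, ?_⟩
    · rw [← hφx]; exact φ.map_source hxs
    · show φ.symm (0, 0) ∈ U'
      rw [← hφx, φ.left_inv hxs]; exact hxU'
  obtain ⟨r, hr, hball⟩ := Metric.isOpen_iff.1 hTo _ h0T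
  -- the neighbourhood `N = source ∩ φ ⁻¹' ball 0 r`
  set B : Set (F × f'.ker) := ball (0 : F × f'.ker) r with hB
  set N := φ.source ∩ φ ⁻¹' B with hN
  have hNo : IsOpen N := φ.isOpen_inter_preimage isOpen_ball
  have hxN : x ∈ N := ⟨hxs, by show φ x ∈ B; rw [hφx, hB]; exact mem_ball_self hr⟩
  refine ⟨N, hNo.mem_nhds hxN, fun z hz => ?_, ?_⟩
  · have h1 : φ z ∈ T := hball hz.2
    have h2 : φ.symm (φ z) = z := φ.left_inv hz.1
    have := h1.2
    rw [mem_preimage, h2] at this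
    exact hU'U this
  · -- `Z ∩ N = φ.symm '' (B ∩ {p | p.1 = 0})`
    have hset : {z | f z = 0} ∩ N = φ.symm '' (B ∩ {p | p.1 = 0}) := by
      ext z
      constructor
      · rintro ⟨hz0, hzs, hzB⟩
        refine ⟨φ z, ⟨hzB, ?_⟩, φ.left_inv hzs⟩
        show (φ z).1 = 0
        rw [hfst, hz0]
      · rintro ⟨p, ⟨hpB, hp1⟩, rfl⟩
        have hpT : p ∈ T := hball hpB
        have hps : φ.symm p ∈ φ.source := φ.map_target hpT.1
        have hφp : φ (φ.symm p) = p := φ.right_inv hpT.1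
        refine ⟨?_, hps, ?_⟩
        · show f (φ.symm p) = 0
          rw [← hfst, hφp]
          exact hp1
        · show φ (φ.symm p) ∈ B
          rw [hφp]; exact hpB
    rw [hset]
    -- `B ∩ {p.1 = 0}` is the image of a ball of `ker f'`, hence connected
    have hslice : B ∩ {p : F × f'.ker | p.1 = 0} =
        (fun v : f'.ker => ((0 : F), v)) '' ball (0 : f'.ker) r := by
      ext ⟨a, v⟩
      simp only [mem_inter_iff, mem_setOf_eq, mem_image, Prod.mk.injEq, hB, mem_ball, dist_zero_right,
        Prod.norm_def]
      constructor
      · rintro ⟨h, rfl⟩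
        refine ⟨v, ?_, rfl, rfl⟩
        simpa using h
      · rintro ⟨w, hw, rfl, rfl⟩
        exact ⟨by simpa using hw, rfl⟩
    have hconn : IsConnected (B ∩ {p : F × f'.ker | p.1 = 0}) := by
      rw [hslice]
      refine ((convex_ball (0 : f'.ker) r).isConnected ⟨0, mem_ball_self hr⟩).image _ ?_
      exact ((continuous_const (y := (0 : F))).prodMk continuous_id).continuousOn
    refine hconn.image _ (φ.symm.continuousOn.mono fun p hp => (hball hp.1).1)

/-- At a regular zero, the connected component of the zero set is a neighbourhood within the zero
set (regular zero sets are locally connected). [cite: MilnorTDV1965, §1] -/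
theorem exists_nhds_inter_subset_connectedComponentIn {f : E → F} {f' : E →L[ℝ] F} {x : E}
    (hf : HasStrictFDerivAt f f' x) (hf' : f'.range = ⊤) (hx : f x = 0) :
    ∃ N ∈ 𝓝 x, N ∩ {z | f z = 0} ⊆ connectedComponentIn {z | f z = 0} x := by
  obtain ⟨N, hN, -, hconn⟩ := exists_nhds_subset_isConnected_inter hf hf' hx univ_mem
  refine ⟨N, hN, fun z hz => ?_⟩
  have hxmem : x ∈ {z | f z = 0} ∩ N := ⟨hx, mem_of_mem_nhds hN⟩
  exact (hconn.isPreconnected.subset_connectedComponentIn hxmem inter_subset_left) ⟨hz.2, hz.1⟩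

/-- If `f` is continuous (so its zero set is closed) and every zero of `f` is regular, the
complement in the zero set of one of its connected components is closed (components are open in
the zero set). [cite: MilnorTDV1965, §1] -/
theorem isClosed_diff_connectedComponentIn {f : E → F} (hcont : Continuous f)
    (hreg : ∀ x, f x = 0 → ∃ f' : E →L[ℝ] F, HasStrictFDerivAt f f' x ∧ f'.range = ⊤) (x : E) :
    IsClosed ({z | f z = 0} \ connectedComponentIn {z | f z = 0} x) := by
  have hZ : IsClosed {z | f z = 0} := isClosed_eq hcont continuous_const
  refine isClosed_of_closure_subset fun z hz => ?_
  have hzZ : z ∈ {z | f z = 0} :=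
    hZ.closure_subset (closure_mono sdiff_subset hz)
  refine ⟨hzZ, fun hzC => ?_⟩
  obtain ⟨f', hf, hf'⟩ := hreg z hzZ
  obtain ⟨N, hN, hNsub⟩ := exists_nhds_inter_subset_connectedComponentIn hf hf' hzZ
  rw [← connectedComponentIn_eq hzC] at hNsub
  rw [mem_closure_iff_nhds] at hz
  obtain ⟨y, hyN, hyZ, hyC⟩ := hz N hN
  exact hyC (hNsub ⟨hyN, hyZ⟩)

omit [FiniteDimensional ℝ E] [FiniteDimensional ℝ F] in
/-- **Local solvability at a regular point**: every value sufficiently close to `f x` is taken by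
`f` in any prescribed neighbourhood of `x`. [folklore] -/
theorem eventually_exists_mem_eq [CompleteSpace E] [CompleteSpace F] {f : E → F} {f' : E →L[ℝ] F}
    {x : E} (hf : HasStrictFDerivAt f f' x) (hf' : f'.range = ⊤) {U : Set E} (hU : U ∈ 𝓝 x) :
    ∀ᶠ e in 𝓝 (f x), ∃ z ∈ U, f z = e := by
  have h := hf.map_nhds_eq_of_surj hf'
  have : f '' U ∈ 𝓝 (f x) := by rw [← h]; exact image_mem_map hU
  filter_upwards [this] with e he
  obtain ⟨z, hz, rfl⟩ := he
  exact ⟨z, hz, rfl⟩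

end Literature.Analysis.Calculus
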